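import Literature.Claims.NS.Stanley2025
import Summits.NavierStokesRegularity.NavierStokesRegularity.Theorems.SoloRefuteStanley2025L14
import Literature.Analysis.FluidPDE.TorusClassicalNSForcedRestart
import Literature.Analysis.FluidPDE.TorusNSPressureGradientBudget
import Literature.Analysis.FluidPDE.OnsagerBDSVStability33
import Literature.Analysis.FunctionSpaces.TorusWeaklyHarmonic
import HarnessLib

/-!
# C85 `Stanley2025` — Lemma 14 p.26 at the SOLUTION grain: `¬ Step_L14` (UG cross-check programme)

Cell `ns-claims` (D-0090), row C85 (ADJUDICATED #96: first failing step `Step_L14` = Lemma 14 p.26,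
class unfilled gap as printed; field-level companion `not_Step_L14Abs` LANDED, p493502). The chair's
UG-programme question (RULINGS v1.31f (3)): is the SOLUTION-level `Step_L14` kernel-reachable WITHOUT an
unproved periodic short-time existence fact? YES — periodic short-time existence is a THEOREM of the tree
(`Literature.Analysis.FluidPDE.Torus.exists_classicalNS_forced_local`, TorusClassicalNSForcedRestart.lean:
every smooth divergence-free datum on `𝕋ᵈ` launches a classical solution on a closed slab `[a, a+θ]`,
`θ > 0`, with `u a = u₀`), and this file runs the reduction:

* `step_L14Abs_of_step_L14 : Step_L14 → Step_L14Abs` — given a smooth divergence-free field `u` and a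
  smooth `p` with `Δp = −div((u·∇)u)`, launch the classical solution `(U, P)` from `u` on `[0, θ]`
  (`ν = 1`, `f = 0`); Lemma 14 along it at `t = 0` gives `I_conv(u) + I_press(u, P 0) = 0`; the
  solution's pressure satisfies the pressure Poisson equation at the endpoint `t = 0` as well
  (`Torus.classicalNS_laplacian_pressure_eq_neg_sum`, one-sided time derivative), so `Δ(P 0 − p) = 0`
  (`BDSV.divergence_convect_eq_sum`), hence `P 0 − p` is constant on `𝕋³`
  (`Torus.IsSmooth.eq_integral_of_laplacian_eq_zero`), `∇(P 0) = ∇p`, and `I_press(u, P 0) = I_press(u, p)`;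
* `not_Step_L14 : ¬ Step_L14` — from the landed field-level countermodel `not_Step_L14Abs` (datum
  `u0 = (sin 2πx₂, sin 2πx₁, cos 2πx₁ + cos 2π(x₁+x₂))`, `p0 = cos 2πx₁ cos 2πx₂`, `η = 10⁴`).

Reading for the record (the chair's token call): Lemma 14 p.26 is false along an actual classical
periodic Navier–Stokes solution (the one issued from `u0`), not only at the field grain.

WHAT THIS IS NOT: not a claim about NS regularity or blow-up; not a claim about any author beyond the
typed locator.
-/

set_option linter.dupNamespace false

noncomputable section
open Set Function MeasureTheory Filter Topology UnitAddTorus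
open scoped ContDiff RealInnerProductSpace InnerProductSpace

namespace Summit.NavierStokesRegularity.NavierStokesRegularity.Theorems.Stanley2025

open Literature.Analysis.FunctionSpaces Literature.Analysis.FunctionSpaces.Torus
  Literature.Analysis.FluidPDE Literature.Claims.NS.Stanley2025

/-- `I_press` depends on the pressure only through its gradient. [cite: Stanley2025, Lemma 14 p.26] -/
theorem Ipress_congr_gradient {η : ℝ} {u : T3 → E3} {p q : T3 → ℝ}
    (h : ∀ x, Torus.gradient p x = Torus.gradient q x) : Ipress η u p = Ipress η u q := by
  unfold Ipress
  simp_rw [h]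

/-- The zero space–time field on `𝕋³` is jointly smooth, divergence free and has zero time derivative
within any time set (the trivial «background» for `Torus.exists_classicalNS_forced_local` with `f = 0`).
[folklore] -/
private theorem zero_background (a b : ℝ) :
    Torus.IsSmoothSpaceTimeOn (Icc a b) (fun (_ : ℝ) (_ : T3) => (0 : E3)) ∧
    (∀ t ∈ Icc a b, Torus.IsDivFree ((fun (_ : ℝ) (_ : T3) => (0 : E3)) t)) ∧
    (∀ t ∈ Icc a b, ∀ x : T3,
      Torus.timeDerivWithin (Icc a b) (fun (_ : ℝ) (_ : T3) => (0 : E3)) t x =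
        (fun (_ : ℝ) (_ : T3) => (0 : E3)) t x) := by
  refine ⟨isSmoothSpaceTimeOn_const (isSmooth_const (0 : E3)) (Icc a b), ?_, ?_⟩
  · intro t _ x
    simp [Torus.divergence, Torus.partialDeriv, Torus.lineDeriv]
  · intro t _ x
    simp [Torus.timeDerivWithin]

/-- **Lemma 14 along solutions implies Lemma 14 at the field grain.** Every smooth divergence-free
field on `𝕋³` is the initial slice of a classical Navier–Stokes solution on a closed slab
(`Torus.exists_classicalNS_forced_local`, `ν = 1`, `f = 0`); the solution's pressure at `t = 0` solves the
same Poisson equation as the given `p` (`Torus.classicalNS_laplacian_pressure_eq_neg_sum` at the endpoint +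
`BDSV.divergence_convect_eq_sum`), so the two pressures differ by a constant
(`Torus.IsSmooth.eq_integral_of_laplacian_eq_zero`) and have the same gradient.
[cite: Stanley2025, Lemma 14 p.26] -/
theorem step_L14Abs_of_step_L14 (h : Step_L14) : Step_L14Abs := by
  intro η u p hη hu hdiv hp hpoisson
  -- launch a classical solution from `u` on a closed slab `[0, θ]`
  obtain ⟨hū, hūdiv, hf⟩ := zero_background 0 1
  obtain ⟨θ, hθ, -, U, P, hsol₀, hU0⟩ :=
    Torus.exists_classicalNS_forced_local (d := Fin 3) one_pos (zero_lt_one' ℝ) hū hūdiv hf hu hdiv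
  have hsol : Torus.IsClassicalNSSolutionOn (Icc 0 θ) 1 0 U P := by
    rw [zero_add] at hsol₀
    exact hsol₀
  -- Lemma 14 along the solution at `t = 0`
  have h0 := h η 1 (Icc 0 θ) U P hη one_pos hsol 0 ⟨le_rfl, hθ.le⟩
  rw [hU0] at h0
  -- the solution's pressure at `t = 0` solves the same Poisson equation
  have hP0s : Torus.IsSmooth (P 0) := hsol.smooth_pressure.isSmooth_slice ⟨le_rfl, hθ.le⟩
  have hlapP : ∀ x, Torus.laplacian (P 0) x = -Torus.divergence (Torus.convect u u) x := by
    intro x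
    rw [Torus.classicalNS_laplacian_pressure_eq_neg_sum hθ hsol ⟨le_rfl, hθ.le⟩ x, hU0,
      BDSV.divergence_convect_eq_sum hu hu hdiv x]
  -- hence `P 0 - p` is harmonic, so constant, so the gradients agree
  have hq : Torus.IsSmooth (P 0 - p) := hP0s.sub hp
  have hlapq : ∀ x, Torus.laplacian (P 0 - p) x = 0 := by
    intro x
    rw [laplacian_sub hP0s hp, Pi.sub_apply, hlapP x, hpoisson x, sub_self]
  have hconst : ∀ x, (P 0 - p) x = ∫ y, (P 0 - p) y :=
    fun x => hq.eq_integral_of_laplacian_eq_zero hlapq x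
  have hgrad : ∀ x, Torus.gradient (P 0) x = Torus.gradient p x := by
    intro x
    have hfun : P 0 - p = fun _ => ∫ y, (P 0 - p) y := funext hconst
    have h1 : Torus.gradient (P 0 - p) x = 0 := by
      rw [hfun]
      unfold Torus.gradient liftAt
      simp [_root_.gradient]
    have h2 := gradient_sub (hP0s.isContDiff (n := 1) (by simp)) (hp.isContDiff (n := 1) (by simp)) x
    rw [h2] at h1
    exact sub_eq_zero.mp h1
  rw [Ipress_congr_gradient hgrad] at h0
  exact h0

/-- **`Step_L14` is false at the SOLUTION grain**: Lemma 14 p.26 fails along the classical periodic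
Navier–Stokes solution issued from the field-level witness datum `u0` of `not_Step_L14Abs` (p493502).
[cite: Stanley2025, Lemma 14 p.26] -/
theorem not_Step_L14 : ¬ Step_L14 := fun h => not_Step_L14Abs (step_L14Abs_of_step_L14 h)

end Summit.NavierStokesRegularity.NavierStokesRegularity.Theorems.Stanley2025

end
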